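import Mathlib
import Literature.Barriers.ValiantsHypothesis.CKRST20NaturalProofsExist
import Summits.ValiantsHypothesis.ValiantsHypothesis.Theorems.BarrierLeverSuccinctHittingSetsForVPDimensionCount
import Summits.ValiantsHypothesis.ValiantsHypothesis.Theorems.BarrierLeverNaturalProofsSeparateVNPSignSliceCRT
import Summits.ValiantsHypothesis.ValiantsHypothesis.Theorems.BarrierLeverNaturalProofsSeparateVNPSignSliceCoeffs
import Summits.ValiantsHypothesis.ValiantsHypothesis.Theorems.BarrierLeverNaturalProofsSeparateVNPSignSliceEquationGen
import Summits.ValiantsHypothesis.ValiantsHypothesis.Theorems.BarrierLeverNaturalProofsSeparateVNPSignSliceHitGen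
import Summits.ValiantsHypothesis.ValiantsHypothesis.Theorems.BarrierLeverNaturalProofsSeparateVNPSignSliceAsPrintedBounds
import HarnessLib

/-!
# Item `BarrierLever.NaturalProofsSeparateVNP` (stmt-ValiantsHypothesis-18972), SIGN SLICE —
# part 11: CKRST 2020 Thm. 1.1 AS PRINTED — discharge of the named fact `CKRST2020_thm_1_1`

**What is proved (unconditional).** The named fact
`Literature.Barriers.ValiantsHypothesis.CKRST2020_thm_1_1` (Chatterjee–Kumar–Ramya–Saptharishi–Tengse
2020, Thm. 1.1 as printed, typed by the cell val-lit in `CKRST20NaturalProofsExist.lean`): for every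
`c ≥ 1` there are `e` (here `5`) and ONE family `P_n` of polynomials in the `N = C(n + n^c, n)`
coefficient variables `monomialsDegLE n (n^c)` with, eventually in `n`, size and degree `≤ N^e`;
for EVERY size exponent `k`, eventually in `n`, `P_n` vanishes at the coefficient vector of every
`n`-variate polynomial of degree `≤ n^c`, size `≤ n^k` and coefficients in `{0, 1, -1}`; and,
eventually, `P_n` is nonzero at some sign polynomial of degree `≤ n^c`
(`AsPrinted.ckrst2020_thm_1_1_holds`). Consequently the tree-frame corollaries of that file
(`CKRST2020_thm_1_1.frame`, `.forall_exists`, `.not_succinctHittingSetsForVPRel`) hold outright.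

**Construction (CKRST §4).** `P_n = Λ · ∏_{r=2}^{2N} Q_{2N²,r}(∑_m z_m (a_n^m mod r))` (part 7) where
`a_n ∈ ℕ^n` is the hitting point of part 9 for CKRST's class `𝒞(n, n^c, s(n))` with the barely
super-polynomial size schedule `s(n) = n^{⌊log₂ n⌋}` (so that `𝒞(n, n^c, n^k) ⊆ 𝒞(n, n^c, s(n))`
once `n ≥ 2^k`: one family serves all `k`, as in print). Vanishing: a nonzero sign polynomial `f` of
the class has `0 ≠ |f(a_n)| ≤ N · B^{n^c} < 2^N` (part 10), so some `r ≤ 2N` does not divide `f(a_n)`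
(part 2) and `Q_{2N²,r}` kills the proxy sum; non-vanishing: Siegel's pigeonhole (part 6) gives a
nonzero sign vector `e` with `∑_m e_m a_n^m = 0`. Deviations from print: Heintz–Schnorr's hitting
set is replaced by one point (zero-pattern count), primes by all moduli `r ≤ 2N`, and `Λ` is squared.

WHAT THIS IS NOT: nothing on FSV Question 6 / crux 14610, on item 18972 proper (all coefficients,
`VNP`-explicit witness), or on `VP ≠ VNP`.

References: [ChatterjeeKumarRamyaSaptharishiTengse2020] Thm. 1.1, §4; [Raz2010] Prop. 3.3;
[RonyaiBabaiGanapathy2001] Thm. 1.1; [ForbesShpilkaVolk2018] Def. 1–3.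
-/

-- layout Summits/ValiantsHypothesis/ValiantsHypothesis forces the duplicated namespace component
set_option linter.dupNamespace false

noncomputable section

namespace Summit.ValiantsHypothesis.ValiantsHypothesis.Theorems.BarrierLever.NaturalProofsSeparateVNP

open Literature.Barriers.ValiantsHypothesis Literature.Computability.AlgebraicComplexity MvPolynomial
open Summit.ValiantsHypothesis.ValiantsHypothesis.Theorems.BarrierLever.SuccinctHittingSetsForVP
open SignSlice (monoVal)

namespace AsPrinted

/-- CKRST's size schedule `s(n) = n^{⌊log₂ n⌋}` ("`s_n = n^{log n}`, barely super-polynomial").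
[cite: ChatterjeeKumarRamyaSaptharishiTengse2020, §4] -/
def sched (n : ℕ) : ℕ := n ^ Nat.log 2 n

/-- Every polynomial size bound `n^k` is eventually below the schedule: `n^k ≤ s(n)` for `n ≥ 2^k`.
[cite: ChatterjeeKumarRamyaSaptharishiTengse2020, §4] -/
theorem pow_le_sched {n k : ℕ} (hn : 1 ≤ n) (h : 2 ^ k ≤ n) : n ^ k ≤ sched n :=
  Nat.pow_le_pow_right hn (Nat.le_log_of_pow_le (by norm_num) h)

/-- The hitting point of part 9 for the class `𝒞(n, n^c, s(n))` (`n ≥ 1`).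
[cite: ChatterjeeKumarRamyaSaptharishiTengse2020, Lemma 12 and §4] -/
def hitPt (c n : ℕ) (hn : 1 ≤ n) : Fin n → ℕ :=
  Classical.choose (HitGen.exists_hitting_point n (n ^ c) (sched n) hn (Nat.one_le_pow _ _ hn))

/-- Its defining property. [cite: ChatterjeeKumarRamyaSaptharishiTengse2020, Lemma 12 and §4] -/
theorem hitPt_spec (c n : ℕ) (hn : 1 ≤ n) :
    (∀ i, 1 ≤ hitPt c n hn i ∧ hitPt c n hn i ≤ HitGen.hitBoundGen n (n ^ c) (sched n)) ∧
      ∀ f ∈ vpSlice ℂ n (n ^ c) (sched n), f ∈ signCoeffSlice ℂ n → f ≠ 0 →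
        eval (fun i => (hitPt c n hn i : ℂ)) f ≠ 0 :=
  Classical.choose_spec (HitGen.exists_hitting_point n (n ^ c) (sched n) hn (Nat.one_le_pow _ _ hn))

/-- **The as-printed family `P_{N,c}`**: the CKRST equation of part 7 on the coefficient variables
`monomialsDegLE n (n^c)` with true values `a_n^m`, moduli `r ≤ 2N` and range `2N²` (and `0` for
`n = 0`). [cite: ChatterjeeKumarRamyaSaptharishiTengse2020, Thm. 1.1 and §4] -/
def eqn (c n : ℕ) : MvPolynomial (monomialsDegLE n (n ^ c)) ℂ :=
  if hn : 1 ≤ n then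
    letI := HitGen.monFintype n (n ^ c)
    EqGen.equation (fun m : monomialsDegLE n (n ^ c) => monoVal (hitPt c n hn) m)
      (2 * Fintype.card (monomialsDegLE n (n ^ c)))
      (Fintype.card (monomialsDegLE n (n ^ c)) * (2 * Fintype.card (monomialsDegLE n (n ^ c))))
  else 0

/-- The true values of part 7 at `v_m = a^m` are the integer evaluation of part 6. [folklore] -/
theorem trueVal_monoVal {n : ℕ} {M : Set (Fin n →₀ ℕ)} [Fintype M] (a : Fin n → ℕ) (e : M → ℤ) :
    EqGen.trueVal (fun m : M => monoVal a m) e = Coeffs.intEval a e := rfl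

/-- **The as-printed family at a good `n`**: size and degree `≤ N^5`, vanishing on the sign
polynomials of `𝒞(n, n^c, s(n))`, and a sign witness of degree `≤ n^c` — given `n ≥ 6` and the
pigeonhole inequality of part 10. [cite: ChatterjeeKumarRamyaSaptharishiTengse2020, Thm. 1.1 and §4] -/
theorem eqn_spec (c : ℕ) (hc : 1 ≤ c) {n : ℕ} (hn6 : 6 ≤ n)
    (hkey : (n + n ^ c).choose (n ^ c) *
        ((4 * n ^ c * (n + n ^ c).choose (n ^ c) + 1) ^
            (9376 * (n + n ^ c + n ^ Nat.log 2 n + 4) ^ 21) * n ^ c + 1) ^ (n ^ c) + 1 <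
      2 ^ (n + n ^ c).choose (n ^ c)) :
    (complexity (eqn c n) ≤ ((n + n ^ c).choose n) ^ 5 ∧
        (eqn c n).totalDegree ≤ ((n + n ^ c).choose n) ^ 5) ∧
      (∀ f ∈ vpSlice ℂ n (n ^ c) (sched n), f ∈ signCoeffSlice ℂ n →
        eval (coeffVector (monomialsDegLE n (n ^ c)) f) (eqn c n) = 0) ∧
      (∃ h ∈ signCoeffSlice ℂ n, h.totalDegree ≤ n ^ c ∧
        eval (coeffVector (monomialsDegLE n (n ^ c)) h) (eqn c n) ≠ 0) := by
  classical
  have hn1 : 1 ≤ n := by omega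
  letI inst : Fintype (monomialsDegLE n (n ^ c)) := HitGen.monFintype n (n ^ c)
  -- unfold the family at `n ≥ 1` and name `N = #monomialsDegLE n (n^c)`
  have heqn : eqn c n = @EqGen.equation _ (HitGen.monFintype n (n ^ c))
      (fun m : monomialsDegLE n (n ^ c) => monoVal (hitPt c n hn1) m)
      (2 * @Fintype.card _ (HitGen.monFintype n (n ^ c)))
      (@Fintype.card _ (HitGen.monFintype n (n ^ c)) *
        (2 * @Fintype.card _ (HitGen.monFintype n (n ^ c)))) := dif_pos hn1
  obtain ⟨N, hN⟩ : ∃ N, Fintype.card (monomialsDegLE n (n ^ c)) = N := ⟨_, rfl⟩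
  have hNc : N = (n + n ^ c).choose (n ^ c) := by rw [← hN]; exact HitGen.card_monomialsDegLE n (n ^ c)
  have hNn : (n + n ^ c).choose n = N := by rw [hNc, Nat.choose_symm_add]
  rw [heqn, hN]
  obtain ⟨ha', hhit⟩ := hitPt_spec c n hn1
  have hB1 : 1 ≤ HitGen.hitBoundGen n (n ^ c) (sched n) := HitGen.one_le_hitBoundGen n (n ^ c) (sched n)
  have haB : ∀ i, hitPt c n hn1 i ≤ HitGen.hitBoundGen n (n ^ c) (sched n) := fun i => (ha' i).2
  -- the pigeonhole inequality, in the local names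
  have hkey' : N * HitGen.hitBoundGen n (n ^ c) (sched n) ^ (n ^ c) + 1 < 2 ^ N := by
    rw [hNc]; exact hkey
  -- `N ≥ 64`
  have hN64 : 64 ≤ N := by
    have h1 : 2 ^ n ≤ (2 * n).choose n := LowDegreeEquations.two_pow_le_choose (by omega)
    have h2 : (2 * n).choose n ≤ (n + n ^ c).choose n := by
      refine Nat.choose_le_choose n ?_
      have : n ≤ n ^ c := by
        calc n = n ^ 1 := (pow_one n).symm
          _ ≤ n ^ c := Nat.pow_le_pow_right hn1 hc
      omega
    have h3 : (64 : ℕ) ≤ 2 ^ n :=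
      calc (64 : ℕ) = 2 ^ 6 := by norm_num
        _ ≤ 2 ^ n := Nat.pow_le_pow_right (by norm_num) hn6
    rw [← hNn]; exact h3.trans (h1.trans h2)
  have hN1 : 1 ≤ N := by omega
  have hMdeg : ∀ m : monomialsDegLE n (n ^ c), (m : Fin n →₀ ℕ).degree ≤ n ^ c :=
    HitGen.degree_le_of_mem n (n ^ c)
  have hMmem : ∀ μ : Fin n →₀ ℕ, μ.degree ≤ n ^ c → μ ∈ monomialsDegLE n (n ^ c) :=
    HitGen.mem_of_degree_le n (n ^ c)
  refine ⟨?_, ?_, ?_⟩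
  · -- size and degree
    rw [hNn]
    have hdeg := EqGen.totalDegree_equation_le
      (fun m : monomialsDegLE n (n ^ c) => monoVal (hitPt c n hn1) m) (2 * N) (N * (2 * N))
    have hcx := EqGen.complexity_equation_le
      (fun m : monomialsDegLE n (n ^ c) => monoVal (hitPt c n hn1) m) (2 * N) (N * (2 * N))
    rw [hN] at hdeg hcx
    have p3 : N ^ 3 ≤ N ^ 4 := Nat.pow_le_pow_right hN1 (by norm_num)
    have p2 : N ^ 2 ≤ N ^ 4 := Nat.pow_le_pow_right hN1 (by norm_num)
    have p1 : N ≤ N ^ 4 := by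
      calc N = N ^ 1 := (pow_one N).symm
        _ ≤ N ^ 4 := Nat.pow_le_pow_right hN1 (by norm_num)
    have p0 : 1 ≤ N ^ 4 := Nat.one_le_pow _ _ hN1
    have h5 : N ^ 5 = N ^ 4 * N := pow_succ N 4
    refine ⟨hcx.trans ?_, hdeg.trans ?_⟩
    · have expand : 4 * N + 3 + 2 * N * ((2 * (N * (2 * N)) + 1) * (2 * N + 2) + 1) =
          16 * N ^ 4 + 16 * N ^ 3 + 4 * N ^ 2 + 10 * N + 3 := by ring
      calc 4 * N + 3 + 2 * N * ((2 * (N * (2 * N)) + 1) * (2 * N + 2) + 1)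
          ≤ 49 * N ^ 4 := by rw [expand]; linarith
        _ ≤ N ^ 4 * N := by rw [mul_comm]; exact Nat.mul_le_mul_left _ (by omega)
        _ = N ^ 5 := h5.symm
    · have expand : 2 * N + 2 * N * (2 * (N * (2 * N)) + 1) = 8 * N ^ 3 + 4 * N := by ring
      calc 2 * N + 2 * N * (2 * (N * (2 * N)) + 1)
          ≤ 12 * N ^ 4 := by rw [expand]; linarith
        _ ≤ N ^ 4 * N := by rw [mul_comm]; exact Nat.mul_le_mul_left _ (by omega)
        _ = N ^ 5 := h5.symm
  · -- vanishing on the sign polynomials of the class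
    intro f hf hfs
    rw [Coeffs.coeffVector_eq_cast_sgnVec hfs]
    by_cases hf0 : f = 0
    · have : Coeffs.sgnVec (monomialsDegLE n (n ^ c)) f = 0 := by
        funext m; simp [Coeffs.sgnVec, hf0]
      rw [this]
      exact EqGen.eval_equation_zero _ (2 * N) (N * (2 * N))
    · have hx : Coeffs.intEval (hitPt c n hn1) (Coeffs.sgnVec (monomialsDegLE n (n ^ c)) f) ≠ 0 := by
        intro h0
        apply hhit f hf hfs hf0
        rw [Coeffs.eval_natCast_eq_intEval hMmem hfs hf.1, h0, Int.cast_zero]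
      have hxlt : (Coeffs.intEval (hitPt c n hn1)
          (Coeffs.sgnVec (monomialsDegLE n (n ^ c)) f)).natAbs < 2 ^ N := by
        refine lt_of_le_of_lt
          (Coeffs.natAbs_intEval_le hMdeg hB1 haB (Coeffs.natAbs_sgnVec_le f)) ?_
        rw [hN]; omega
      obtain ⟨r, hr2, hrK, hnd⟩ := CRT.exists_not_dvd_int hx hxlt
      have hcard : Fintype.card (monomialsDegLE n (n ^ c)) * (2 * N) ≤ N * (2 * N) := by rw [hN]
      exact EqGen.eval_equation_intCast_eq_zero_of_not_dvd _ hcard (Coeffs.natAbs_sgnVec_le f) hr2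
        hrK (by rw [trueVal_monoVal]; exact hnd)
  · -- the witness
    have hkey'' : Fintype.card (monomialsDegLE n (n ^ c)) *
        HitGen.hitBoundGen n (n ^ c) (sched n) ^ (n ^ c) + 1 <
          2 ^ Fintype.card (monomialsDegLE n (n ^ c)) := by rw [hN]; exact hkey'
    obtain ⟨e, he0, he, hea⟩ := Coeffs.exists_witness hMdeg (hitPt c n hn1) hB1 haB hkey''
    refine ⟨Coeffs.poly e, Coeffs.poly_mem_signCoeffSlice he, Coeffs.totalDegree_poly_le hMdeg e, ?_⟩
    rw [Coeffs.coeffVector_poly]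
    have hcard : Fintype.card (monomialsDegLE n (n ^ c)) * (2 * N) ≤ N * (2 * N) := by rw [hN]
    refine EqGen.eval_equation_intCast_ne_zero _ hcard he he0 fun r _ _ => ?_
    rw [trueVal_monoVal, hea]; exact dvd_zero _

/-- **CKRST 2020, Thm. 1.1, AS PRINTED — the named fact `CKRST2020_thm_1_1` holds.** For every
`c ≥ 1`: one family of `VP`-constructible equations (size and degree `≤ N^5`,
`N = binom(n + n^c, n)`) vanishing, for every size exponent `k` and all large `n`, on the coefficient
vectors of the `n`-variate polynomials of degree `≤ n^c`, size `≤ n^k` and coefficients in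
`{0, 1, -1}`, and nonzero at some sign polynomial of degree `≤ n^c`.
[cite: ChatterjeeKumarRamyaSaptharishiTengse2020, Thm. 1.1] -/
theorem ckrst2020_thm_1_1_holds : CKRST2020_thm_1_1 := by
  intro c hc
  obtain ⟨n₀, hn₀⟩ := AsPrintedBounds.threshold c hc
  refine ⟨5, eqn c, ⟨n₀, fun n hn => (eqn_spec c hc (hn₀ n hn).1 (hn₀ n hn).2).1⟩, ?_,
    ⟨n₀, fun n hn => (eqn_spec c hc (hn₀ n hn).1 (hn₀ n hn).2).2.2⟩⟩
  intro k
  refine ⟨max n₀ (2 ^ k), fun n hn f hf hfs => ?_⟩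
  have hn' : n₀ ≤ n := le_of_max_le_left hn
  have h2k : 2 ^ k ≤ n := le_of_max_le_right hn
  have hn1 : 1 ≤ n := le_trans (by omega) (hn₀ n hn').1
  have hsub : f ∈ vpSlice ℂ n (n ^ c) (sched n) := ⟨hf.1, hf.2.trans (pow_le_sched hn1 h2k)⟩
  exact (eqn_spec c hc (hn₀ n hn').1 (hn₀ n hn').2).2.1 f hsub hfs

end AsPrinted

end Summit.ValiantsHypothesis.ValiantsHypothesis.Theorems.BarrierLever.NaturalProofsSeparateVNP
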